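import Summits.MatrixMultiplication.OmegaCensus.SmallFormats.MatMul22nAllOnesRowTypes
import Summits.MatrixMultiplication.OmegaCensus.SmallFormats.MatMul22nCheapSpansIndep
import HarnessLib

/-!
# ω-census family (a): the column-side twins — W-forms of a loaded column plane are independent; the λ-LINE STRUCTURE of an all-ones COLUMN over `𝔽₃`

Cell `pub-omega` (unit `pub-omega-tensor`, gen 40), topic `Summits/MatrixMultiplication/OmegaCensus` (sub-folder
`SmallFormats`). Framing (verbatim): lottery ticket; floor = certified bounds/negative ranges. HONEST FRAMING: M1-LEAN-BLUEPRINT F1 (column side), obtained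
from the row versions through the transpose-dual computation `exists_transposeDual'` (`(f, g, w) ↦ (f∘ᵀ, ⟨w,·⟩, G)`): `wForms_linearIndependent` (any field; twin
of `CheapSpans.gForms_linearIndependent`) and `AllOnesColTypes.col_structure` (`𝔽₃`; twin of `AllOnesRowTypes.row_structure`: the λ-line map of an all-ones
column is not injective, has no triple, and the terms at rows outside a coincident pair have both OUTPUT rows proportional to the kill covector
`∑_l rep(L a)_l • b l`). Nothing here is a bound on `ω`.
-/

namespace Summit.MatrixMultiplication.OmegaCensus.SmallFormats

open Finset Module Matrix
open Literature.Computability.AlgebraicComplexity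
open Summit.MatrixMultiplication.OmegaCensus.RankOnePlaneCapGeneral

namespace AllOnesColTypes

variable {k : Type*} [Field k] {n : ℕ} {ι : Type*} [Fintype ι]

/-- The pairing `W ↦ ⟨W, ·⟩` (`⟨W, Y'⟩ = ∑ W κ j Y' κ j`) is an injective linear map into the dual. -/
theorem exists_pairingMap :
    ∃ Ψ : Matrix (Fin 2) (Fin n) k →ₗ[k] Module.Dual k (Matrix (Fin 2) (Fin n) k),
      (∀ W Y', Ψ W Y' = ∑ κ, ∑ j, W κ j * Y' κ j) ∧ LinearMap.ker Ψ = ⊥ := by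
  refine ⟨{ toFun := fun W =>
              { toFun := fun Y' => ∑ κ, ∑ j, W κ j * Y' κ j
                map_add' := fun Y Y' => by simp only [Matrix.add_apply, mul_add, Finset.sum_add_distrib]
                map_smul' := fun a Y => by
                  simp only [Matrix.smul_apply, smul_eq_mul, RingHom.id_apply, Finset.mul_sum]
                  exact Finset.sum_congr rfl fun κ _ => Finset.sum_congr rfl fun j _ => by ring }
            map_add' := fun W W' => by
              ext Y'; simp only [Matrix.add_apply, add_mul, Finset.sum_add_distrib, LinearMap.coe_mk, AddHom.coe_mk, LinearMap.add_apply]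
            map_smul' := fun a W => by
              ext Y'
              simp only [Matrix.smul_apply, smul_eq_mul, RingHom.id_apply, LinearMap.coe_mk, AddHom.coe_mk, LinearMap.smul_apply,
                Finset.mul_sum]
              exact Finset.sum_congr rfl fun κ _ => Finset.sum_congr rfl fun j _ => by ring }, fun W Y' => rfl, ?_⟩
  rw [LinearMap.ker_eq_bot']
  intro W hW
  ext κ j
  have := congrArg (fun φ : Module.Dual k (Matrix (Fin 2) (Fin n) k) => φ (Matrix.single κ j 1)) hW
  simp only [LinearMap.coe_mk, AddHom.coe_mk, LinearMap.zero_apply] at this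
  rw [CheapSpans.sum_w_mul_single] at this
  simpa using this

/-- **W-forms of a loaded column plane are linearly independent** (any field): cheap input vectors `b 0, b 1` (independent) for a 4-set `S`
(`g_t(ν (b m)ᵀ) = 0` off `S`, `ν ≠ 0`) force the four output matrices `W_s` to be linearly independent. -/
theorem wForms_linearIndependent (β : BilinComp (mulBilin k 2 2 n) ι) (ν : Fin 2 → k) (hν : ν ≠ 0) (S : Finset ι) (hS4 : S.card = 4)
    (b : Fin 2 → (Fin n → k)) (hind : ∀ a : Fin 2 → k, ∑ m, a m • b m = 0 → ∀ m, a m = 0)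
    (hcheap : ∀ t, t ∉ S → ∀ m, β.g t (Matrix.vecMulVec ν (b m)) = 0) :
    LinearIndependent k (fun s : S => β.w s) := by
  classical
  obtain ⟨β', -, hg, hw⟩ := exists_transposeDual' β
  have hcheap' : ∀ t, t ∉ S → ∀ m, ∑ i, b m i * (Matrix.vecMul ν (β'.w t)) i = 0 := by
    intro t ht m
    rw [hw, ← CheapSpans.g_vecMulVec_eq_sum]
    exact hcheap t ht m
  have hli := CheapSpans.gForms_linearIndependent β' ν hν S hS4 b hind hcheap'
  -- transfer along the injective linear map W ↦ ⟨W, ·⟩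
  obtain ⟨Ψ, hΨ, -⟩ := exists_pairingMap (k := k) (n := n)
  have hcomp : (fun s : S => β'.g s) = Ψ ∘ (fun s : S => β.w s) := by
    funext s; ext Y'; rw [hg]; exact (hΨ _ _).symm
  rw [hcomp] at hli
  exact LinearIndependent.of_comp Ψ hli

/-- **The λ-line structure of an all-ones COLUMN over `𝔽₃`** (twin of `AllOnesRowTypes.row_structure`): column cheap plane `span(b)` with its four terms
`t j` in the four row planes `R j` (row direction `λ_j =` the `j`-th point; cheap output data `c j`), each outside the other three row planes, with linearly
independent outputs. -/
theorem col_structure [DecidableEq ι] (β : BilinComp (mulBilin (ZMod 3) 2 2 n) ι) (Cμ : Finset ι) (b : Fin 2 → (Fin n → ZMod 3))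
    (hbr : ∀ s, s ∈ Cμ → ∀ κ : Fin 2, ∃ a : Fin 2 → ZMod 3, β.w s κ = ∑ m, a m • b m)
    (R : Fin 4 → Finset ι) (hR4 : ∀ j, (R j).card = 4) (c : Fin 4 → Fin 2 → (Fin n → ZMod 3))
    (hci : ∀ j (a : Fin 2 → ZMod 3), ∑ m, a m • c j m = 0 → ∀ m, a m = 0)
    (hcch : ∀ j t, t ∉ R j → ∀ m, ∑ i, c j m i * (Matrix.vecMul (![-((![![1, 0], ![0, 1], ![1, 1], ![1, 2]] : Fin 4 → Fin 2 → ZMod 3) j 1), (![![1, 0], ![0, 1], ![1, 1], ![1, 2]] : Fin 4 → Fin 2 → ZMod 3) j 0] : Fin 2 → ZMod 3) (β.w t)) i = 0)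
    (t : Fin 4 → ι) (htC : ∀ j, t j ∈ Cμ) (htR : ∀ j, t j ∈ R j) (htR' : ∀ j j', j ≠ j' → t j ∉ R j')
    (hind : LinearIndependent (ZMod 3) (fun j => β.w (t j))) :
    ∃ L : Fin 4 → Fin 4,
      (∀ j m, (∑ l, (![![1, 0], ![0, 1], ![1, 1], ![1, 2]] : Fin 4 → Fin 2 → ZMod 3) (L j) l • b l) ⬝ᵥ c j m = 0) ∧
      (∀ j (x : Fin 2 → ZMod 3), (∀ m, (∑ l, x l • b l) ⬝ᵥ c j m = 0) →
        x 0 * (![![1, 0], ![0, 1], ![1, 1], ![1, 2]] : Fin 4 → Fin 2 → ZMod 3) (L j) 1 - x 1 * (![![1, 0], ![0, 1], ![1, 1], ![1, 2]] : Fin 4 → Fin 2 → ZMod 3) (L j) 0 = 0) ∧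
      (∀ j, ∃ l m, b l ⬝ᵥ c j m ≠ 0) ∧
      ¬ Function.Injective L ∧
      (∀ a b' d, a ≠ b' → a ≠ d → b' ≠ d → ¬ (L a = L b' ∧ L a = L d)) ∧
      (∀ a b' j, a ≠ b' → L a = L b' → j ≠ a → j ≠ b' →
        ∃ ω : Fin 2 → ZMod 3, ∀ q : Fin 2, β.w (t j) q = ω q • ∑ l, (![![1, 0], ![0, 1], ![1, 1], ![1, 2]] : Fin 4 → Fin 2 → ZMod 3) (L a) l • b l) := by
  classical
  obtain ⟨β', -, hg, hw⟩ := exists_transposeDual' β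
  -- translate the hypotheses to the transpose-dual computation
  have hrows' : ∀ s κ, (fun jj => β'.g s (Matrix.single κ jj (1 : ZMod 3))) = β.w s κ := by
    intro s κ; funext jj; rw [hg, CheapSpans.sum_w_mul_single]
  have hcr' : ∀ s, s ∈ Cμ → ∀ κ : Fin 2, ∃ a : Fin 2 → ZMod 3,
      (fun jj => β'.g s (Matrix.single κ jj (1 : ZMod 3))) = ∑ m, a m • b m := by
    intro s hs κ; rw [hrows']; exact hbr s hs κ
  have hbch' : ∀ j t', t' ∉ R j → ∀ m, β'.g t' (Matrix.vecMulVec (![-((![![1, 0], ![0, 1], ![1, 1], ![1, 2]] : Fin 4 → Fin 2 → ZMod 3) j 1), (![![1, 0], ![0, 1], ![1, 1], ![1, 2]] : Fin 4 → Fin 2 → ZMod 3) j 0] : Fin 2 → ZMod 3) (c j m)) = 0 := by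
    intro j t' ht' m
    rw [hg, RowSubcomp.pairing_eq]
    exact hcch j t' ht' m
  have hind' : LinearIndependent (ZMod 3) (fun j => β'.g (t j)) := by
    obtain ⟨Ψ, hΨ, hker⟩ := exists_pairingMap (k := ZMod 3) (n := n)
    have hcomp : (fun j => β'.g (t j)) = Ψ ∘ (fun j => β.w (t j)) := by
      funext j; ext Y'; rw [hg]; exact (hΨ _ _).symm
    rw [hcomp]
    exact hind.map' Ψ hker
  obtain ⟨L, h1, h2, h3, h4, h5, h6⟩ := AllOnesRowTypes.row_structure β' Cμ b hcr' R hR4 c hci hbch' t htC htR htR' hind'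
  refine ⟨L, h1, h2, h3, h4, h5, fun a b' j hab hL hja hjb => ?_⟩
  obtain ⟨η, hη⟩ := h6 a b' j hab hL hja hjb
  exact ⟨η, fun q => by rw [← hrows']; exact hη q⟩

end AllOnesColTypes

end Summit.MatrixMultiplication.OmegaCensus.SmallFormats
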